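import Mathlib
import HarnessLib
import Summits.AtomisticToContinuum.FouriersLaw.Theses.JunctionLocality
import Literature.MathematicalPhysics.KineticTheory.LangevinChainGibbs
import Summits.AtomisticToContinuum.FouriersLaw.Theorems.JunctionLocalitySuperadditiveResistanceKuboFrame
import Summits.AtomisticToContinuum.FouriersLaw.Theorems.JunctionLocalitySuperadditiveResistanceKuboGauss
import Summits.AtomisticToContinuum.FouriersLaw.Theorems.JunctionLocalitySuperadditiveResistanceKuboPlain
import Summits.AtomisticToContinuum.FouriersLaw.Theorems.JunctionLocalitySuperadditiveResistanceTerminationIdentity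

/-!
# Termination locality IV: the junction power pairing and the split termination identity
(stub `stub_terminationLocalityTC` of line `thermalise-then-cut-probe-insertion`, crux
`JunctionLocality.SuperadditiveResistance`, stmt-AtomisticToContinuum-11748)

The landed termination identity (`terminationIdentity_left`, p93070) writes the stub's left defect as
`selfLeft g − G_N = −(γ²/T²)(S_N + Dyn_N)`, `Dyn_N = ⟨gb₁∘R, V'(r_J)(∂_{p_{N−1}} g_N)∘π_N⟩_{μ^{(N+M)}}`.
The end gradient splits as `∂_{p_{N−1}} g_N = (G_N/γ²) p_{N−1} + r_N`, `r_N ⟂ p_{N−1}` (companion file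
`…StubTerminationLocalityTC`, `helper_terminationEndGradient`). This file evaluates the MEAN PART of
`Dyn_N` EXACTLY, at fixed `N, M`, in terms of the Kubo frame's own transfer conductances:

* `leftEnergy_pair` — the bare piece's energy `H_N∘π_N` is a classical pair of the equilibrium device:
  `L_dev(H_N∘π_N) = γ((T − p_0²) + (T − p²_{N−1})) + V'(q_N − q_{N−1}) p_{N−1}` (thermostat powers at the
  two left thermostats + the junction POWER into the left block; block restriction
  `deviceGenerator_comp_restrictLeft`, `X_H H_N = 0`, `∂_{p_i}H_N = p_i`);
* `junctionPower_pairing` — for every classical forward field `gb` of bath 1 of the device: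
  `⟨gb∘R, V'(r_J) p_{N−1}⟩_{μ^{(N+M)}} = γ(⟨gb, p_0² − T⟩ + ⟨gb, p²_{N−1} − T⟩) − T²`
  (cross Green identity `Kubo.cross` of the pair `H_N∘π_N` against the backward pair `(gb∘R, p_0² − T)`,
  `⟨H_N∘π_N, p_0² − T⟩ = T²` by Gaussian integration by parts, reversal invariance of the kinetic pairings);
* `helper_terminationJunctionPower` (registered) — along a Kubo frame `KuboFrame P T N M g gb₁ gb₄`:
  `⟨gb₁∘R, V'(r_J) p_{N−1}⟩_{μ^{(N+M)}} = −(T²/γ)(g₀₂ + g₀₃)`: the backward bath-1 field sees the junction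
  power at the size of the transfer conductances from BEYOND the γ-bathed site `N−1` to bath 1;
* `helper_terminationSplit` (registered) — the SPLIT TERMINATION IDENTITY: along the plain frame of the
  bare piece and the Kubo frame of the device, for every classical forward field `g_N`,
  `selfLeft g − G_N = (G_N/γ)(g₀₂ + g₀₃) − (γ²/T²)(S_N + Dyn_N^{fl})`,
  `Dyn_N^{fl} = ⟨gb₁∘R, V'(r_J)·(∂_{p_{N−1}} g_N∘π_N − (G_N/γ²)p_{N−1})⟩_{μ^{(N+M)}}`,
  i.e. the mean part of the dynamic remainder is the explicit frame quantity `(G_N/γ)(g₀₂ + g₀₃)` and only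
  the static tilt `S_N` and the pairing of the FLUCTUATING end gradient `r_N` (whose `L²(μ^{(N)})` budget is
  `N`-uniform, companion file) remain to be estimated `N`-uniformly.

What is NOT here: any `N`-uniform estimate (the stub's content: `S_N`, `Dyn_N^{fl}` and the size of
`g₀₂ + g₀₃` relative to `G_N · selfLeft g`). References: Eckmann–Pillet–Rey-Bellet, CMP 201 (1999) §3;
Rey-Bellet (2003) Rem. 4.4; Kundu–Dhar–Narayan, J. Stat. Mech. (2009) L03001. Standard axioms only.
-/

noncomputable section

open MeasureTheory Filter Topology ProbabilityTheory
open scoped ContDiff NNReal ENNReal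
open Literature.MathematicalPhysics.KineticTheory.HeatConduction
open Summit.AtomisticToContinuum.FouriersLaw.Theorems.SuperadditiveResistance.DeviceLiouville
  (liouvilleOp bathOp deviceWeight kin_eq_sq deviceGenerator_eq generator_eq_liouvilleOp_add)
open Summit.AtomisticToContinuum.FouriersLaw.Theorems.SuperadditiveResistance.Kubo
  (fluctuation_dissipation gauss_ibp memLp_partialP memLp_kinetic memLp_momentum partition_pos
    integrable_mul_mul_gibbsDensity integrable_sq_mul_gibbsDensity integral_sq_mul_gibbsDensity_eq)

namespace Summit.AtomisticToContinuum.FouriersLaw.Cruxes.SuperadditiveResistance.ThermaliseThenCutProbeInsertion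

/-! ## The junction power pairing (fixed `N`, `M`; exact) -/

section JunctionPower

variable {ω₂ lam β : ℝ} {N M : ℕ}

open Summit.AtomisticToContinuum.FouriersLaw.Theorems.SuperadditiveResistance.TerminationLocality
  (restrictLeft contDiff_restrictLeft contDiff_comp_restrictLeft deviceGenerator_comp_restrictLeft
    memLp_comp_restrictLeft)
open Summit.AtomisticToContinuum.FouriersLaw.Theorems.SuperadditiveResistance.Kubo
  (rev rev_apply contDiff_rev memLp_rev rev_pair cross memLp_hamiltonian integral_rev_mul_gibbsDensity)

/-- **The left-block energy is a classical pair of the equilibrium device** (`N, M ≥ 1`): in the pair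
vocabulary of the Kubo toolkit (`σ = 1`, `c = γ`, weights `deviceWeight`),
`X_H(H_N∘π_N) + γ S_dev(H_N∘π_N) = γ((T − p_0²) + (T − p²_{N−1})) + V'(q_N − q_{N−1}) p_{N−1}`,
`V'(r) = r + βr³`: the two left thermostats' powers plus the junction POWER into the left block. -/
theorem leftEnergy_pair (γ T : ℝ) (hN : 1 ≤ N) (hM : 1 ≤ M) (x : PhaseSpace (N + M)) :
    1 * liouvilleOp (pinnedChain ω₂ lam β γ) (N + M)
        ((pinnedChain ω₂ lam β γ).hamiltonian N ∘ restrictLeft N M) x +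
      γ * bathOp (N + M) (deviceWeight N M) T ((pinnedChain ω₂ lam β γ).hamiltonian N ∘ restrictLeft N M) x =
      -(γ * ((x.2 ⟨0, by omega⟩ ^ 2 - T) + (x.2 ⟨N - 1, by omega⟩ ^ 2 - T)) -
        ((x.1 ⟨N, by omega⟩ - x.1 ⟨N - 1, by omega⟩) + β * (x.1 ⟨N, by omega⟩ - x.1 ⟨N - 1, by omega⟩) ^ 3) *
          x.2 ⟨N - 1, by omega⟩) := by
  have h := deviceGenerator_comp_restrictLeft ω₂ lam β γ T hN hM ((pinnedChain ω₂ lam β γ).hamiltonian N) x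
  rw [deviceGenerator_eq] at h
  have hγ' : (pinnedChain ω₂ lam β γ).γ = γ := rfl
  rw [hγ'] at h
  rw [one_mul, h, generator_eq_liouvilleOp_add, liouvilleOp_hamiltonian (pinnedChain ω₂ lam β γ),
    bathOp_bathWeight_hamiltonian (pinnedChain ω₂ lam β γ) (show 0 < N by omega),
    (pinnedChain ω₂ lam β γ).partialP_hamiltonian, hγ']
  simp only [restrictLeft, Function.comp_apply, Fin.castAdd_mk]
  ring

/-- Density-level form of `junctionPower_pairing`:
`γ(∫ gb (p_0² − T) ρ + ∫ gb (p²_{N−1} − T) ρ) − ∫ (gb∘R) V'(r_J) p_{N−1} ρ = T² ∫ ρ` (`ρ = e^{−H/T}` of the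
`(N+M)`-chain): the cross Green identity for the pair `H_N∘π_N` (`leftEnergy_pair`) against the backward pair
`(gb∘R, p_0² − T)`, `∫ (H_N∘π_N)(p_0² − T) ρ = T² ∫ ρ` (Gaussian integration by parts, `∂_{p_0}(H_N∘π_N) = p_0`),
and reversal invariance of the kinetic pairings. -/
theorem junctionPower_pairing_density (hω : 0 < ω₂) (hl : 0 ≤ lam) (hβ : 0 ≤ β) {γ : ℝ} (hγ : 0 < γ)
    (hN : 1 ≤ N) (hM : 1 ≤ M) {T : ℝ} (hT : 0 < T)
    {gb : PhaseSpace (N + M) → ℝ} (hbC : ContDiff ℝ 2 gb)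
    (hbL2 : MemLp gb 2 ((pinnedChain ω₂ lam β γ).gibbsMeasure (N + M) T))
    (hbpde : ∀ x, deviceGenerator (pinnedChain ω₂ lam β γ) N M (fun _ => T) gb x = -(kin (N + M) 0 x - T)) :
    γ * ((∫ x, gb x * (x.2 ⟨0, by omega⟩ ^ 2 - T) * (pinnedChain ω₂ lam β γ).gibbsDensity (N + M) T x) +
          ∫ x, gb x * (x.2 ⟨N - 1, by omega⟩ ^ 2 - T) * (pinnedChain ω₂ lam β γ).gibbsDensity (N + M) T x) -
        ∫ x, rev gb x *
          (((x.1 ⟨N, by omega⟩ - x.1 ⟨N - 1, by omega⟩) + β * (x.1 ⟨N, by omega⟩ - x.1 ⟨N - 1, by omega⟩) ^ 3) *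
            x.2 ⟨N - 1, by omega⟩) * (pinnedChain ω₂ lam β γ).gibbsDensity (N + M) T x =
      T ^ 2 * ∫ x, (pinnedChain ω₂ lam β γ).gibbsDensity (N + M) T x := by
  set P := pinnedChain ω₂ lam β γ with hP
  have hγ' : P.γ = γ := rfl
  -- the forward pair `(H_N ∘ π_N, kf)`
  set f : PhaseSpace (N + M) → ℝ := P.hamiltonian N ∘ restrictLeft N M with hf
  set kf : PhaseSpace (N + M) → ℝ := fun x =>
    γ * ((x.2 ⟨0, by omega⟩ ^ 2 - T) + (x.2 ⟨N - 1, by omega⟩ ^ 2 - T)) -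
      ((x.1 ⟨N, by omega⟩ - x.1 ⟨N - 1, by omega⟩) + β * (x.1 ⟨N, by omega⟩ - x.1 ⟨N - 1, by omega⟩) ^ 3) *
        x.2 ⟨N - 1, by omega⟩ with hkf
  have hpair_f : ∀ x, 1 * liouvilleOp P (N + M) f x + γ * bathOp (N + M) (deviceWeight N M) T f x = -kf x := by
    intro x
    rw [leftEnergy_pair γ T hN hM x]
  have hHs : ContDiff ℝ 2 (P.hamiltonian N) :=
    (P.contDiff_hamiltonian (pinnedChain_contDiff_U ω₂ lam β γ) (pinnedChain_contDiff_V ω₂ lam β γ) N).of_le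
      (by norm_cast)
  have hfC : ContDiff ℝ 2 f := contDiff_comp_restrictLeft hHs
  have hfL2 : MemLp f 2 (P.gibbsMeasure (N + M) T) :=
    memLp_comp_restrictLeft hω hl hβ γ hN hM hT (memLp_hamiltonian hω hl hβ N hT)
  have hk0' : MemLp (fun x : PhaseSpace (N + M) => x.2 ⟨0, by omega⟩ ^ 2 - T) 2 (P.gibbsMeasure (N + M) T) :=
    memLp_kinetic (γ := γ) hω hl hβ (N + M) hT ⟨0, by omega⟩
  have hk1' : MemLp (fun x : PhaseSpace (N + M) => x.2 ⟨N - 1, by omega⟩ ^ 2 - T) 2 (P.gibbsMeasure (N + M) T) :=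
    memLp_kinetic (γ := γ) hω hl hβ (N + M) hT ⟨N - 1, by omega⟩
  have hJ : MemLp (fun x : PhaseSpace (N + M) =>
      ((x.1 ⟨N, by omega⟩ - x.1 ⟨N - 1, by omega⟩) + β * (x.1 ⟨N, by omega⟩ - x.1 ⟨N - 1, by omega⟩) ^ 3) *
        x.2 ⟨N - 1, by omega⟩) 2 (P.gibbsMeasure (N + M) T) :=
    memLp_junctionForce_mul_comp_restrictLeft hω hl hβ γ hN hM hT (Φ := fun y : PhaseSpace N => y.2 ⟨N - 1, by omega⟩)
      (by fun_prop) (memLp_momentum hω hl hβ N hT ⟨N - 1, by omega⟩)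
  have hkfL2 : MemLp kf 2 (P.gibbsMeasure (N + M) T) := ((hk0'.add hk1').const_mul γ).sub hJ
  -- the backward pair `(gb ∘ R, p_0² − T)`
  have hpair_b : ∀ x, 1 * liouvilleOp P (N + M) gb x + γ * bathOp (N + M) (deviceWeight N M) T gb x =
      -(kin (N + M) 0 x - T) := by
    intro x
    have h1 := hbpde x
    have e : deviceGenerator P N M (fun _ => T) gb x =
        Summit.AtomisticToContinuum.FouriersLaw.Theorems.SuperadditiveResistance.DeviceLiouville.deviceGenerator
          P N M (fun _ => T) gb x := rfl
    rw [e, deviceGenerator_eq, hγ'] at h1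
    rw [one_mul]
    exact h1
  have hpair_rev : ∀ x, -1 * liouvilleOp P (N + M) (rev gb) x +
      γ * bathOp (N + M) (deviceWeight N M) T (rev gb) x = -(kin (N + M) 0 x - T) := by
    intro x
    have h := rev_pair P (deviceWeight N M) T 1 γ hpair_b x
    rw [h, rev_apply, kin_neg_momentum]
  have hrevC : ContDiff ℝ 2 (rev gb) := contDiff_rev hbC
  have hrevL2 : MemLp (rev gb) 2 (P.gibbsMeasure (N + M) T) := memLp_rev hω hl hβ (N + M) hT hbC.continuous hbL2
  have hk0 : MemLp (fun x : PhaseSpace (N + M) => kin (N + M) 0 x - T) 2 (P.gibbsMeasure (N + M) T) := by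
    have e : (fun x : PhaseSpace (N + M) => kin (N + M) 0 x - T) = fun x => x.2 ⟨0, by omega⟩ ^ 2 - T := by
      funext x; rw [kin_eq_sq_line (show 0 < N + M by omega)]
    rw [e]; exact hk0'
  -- the cross Green identity
  have hcross := cross hω hl hβ (N + M) hT (deviceWeight N M) (deviceWeight_nonneg N M) 1 hγ
    hfC hrevC hfL2 hrevL2 hkfL2 hk0 hpair_f hpair_rev
  -- `∫ (H_N∘π_N) (p_0² − T) ρ = T² ∫ ρ`
  have hdf : partialP ⟨0, by omega⟩ f = fun x : PhaseSpace (N + M) => x.2 ⟨0, by omega⟩ := by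
    funext x
    have e := partialP_comp_restrictLeft_castAdd (M := M) (P.hamiltonian N) ⟨0, by omega⟩ x
    rw [P.partialP_hamiltonian, Fin.castAdd_mk] at e
    exact e
  have hT2 : ∫ x, f x * (kin (N + M) 0 x - T) * P.gibbsDensity (N + M) T x = T ^ 2 * ∫ x, P.gibbsDensity (N + M) T x := by
    have h := gauss_ibp hω hl hβ (N + M) hT ⟨0, by omega⟩ (hfC.of_le (by norm_cast)) hfL2
      (by rw [hdf]; exact memLp_momentum hω hl hβ (N + M) hT ⟨0, by omega⟩)
    rw [hdf] at h
    have e1 : ∫ x, f x * (kin (N + M) 0 x - T) * P.gibbsDensity (N + M) T x =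
        ∫ x, (x.2 ⟨0, by omega⟩ ^ 2 - T) * f x * P.gibbsDensity (N + M) T x :=
      integral_congr_ae (ae_of_all _ fun x => by dsimp only; rw [kin_eq_sq_line (show 0 < N + M by omega)]; ring)
    have e2 : ∫ x, x.2 ⟨0, by omega⟩ * x.2 ⟨0, by omega⟩ * P.gibbsDensity (N + M) T x =
        ∫ x, x.2 ⟨0, by omega⟩ ^ 2 * P.gibbsDensity (N + M) T x :=
      integral_congr_ae (ae_of_all _ fun x => by ring)
    rw [e1, h, e2, integral_sq_mul_gibbsDensity_eq hω hl hβ (N + M) hT]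
    ring
  -- `∫ (gb∘R) kf ρ = γ ∫ gb (k_0 + k_{N−1}) ρ − ∫ (gb∘R) V' p_{N−1} ρ`
  have hIa : Integrable fun x => gb x * (x.2 ⟨0, by omega⟩ ^ 2 - T) * P.gibbsDensity (N + M) T x :=
    integrable_mul_mul_gibbsDensity hω hl hβ γ (N + M) hT hbL2 hk0'
  have hIb : Integrable fun x => gb x * (x.2 ⟨N - 1, by omega⟩ ^ 2 - T) * P.gibbsDensity (N + M) T x :=
    integrable_mul_mul_gibbsDensity hω hl hβ γ (N + M) hT hbL2 hk1'
  have hIab : Integrable fun x => rev gb x * (γ * ((x.2 ⟨0, by omega⟩ ^ 2 - T) + (x.2 ⟨N - 1, by omega⟩ ^ 2 - T))) *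
      P.gibbsDensity (N + M) T x :=
    integrable_mul_mul_gibbsDensity hω hl hβ γ (N + M) hT hrevL2 ((hk0'.add hk1').const_mul γ)
  have hIJ : Integrable fun x => rev gb x *
      (((x.1 ⟨N, by omega⟩ - x.1 ⟨N - 1, by omega⟩) + β * (x.1 ⟨N, by omega⟩ - x.1 ⟨N - 1, by omega⟩) ^ 3) *
        x.2 ⟨N - 1, by omega⟩) * P.gibbsDensity (N + M) T x :=
    integrable_mul_mul_gibbsDensity hω hl hβ γ (N + M) hT hrevL2 hJ
  have hsplit : ∫ x, rev gb x * kf x * P.gibbsDensity (N + M) T x =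
      (∫ x, rev gb x * (γ * ((x.2 ⟨0, by omega⟩ ^ 2 - T) + (x.2 ⟨N - 1, by omega⟩ ^ 2 - T))) *
          P.gibbsDensity (N + M) T x) -
        ∫ x, rev gb x *
          (((x.1 ⟨N, by omega⟩ - x.1 ⟨N - 1, by omega⟩) + β * (x.1 ⟨N, by omega⟩ - x.1 ⟨N - 1, by omega⟩) ^ 3) *
            x.2 ⟨N - 1, by omega⟩) * P.gibbsDensity (N + M) T x := by
    rw [← integral_sub hIab hIJ]
    refine integral_congr_ae (ae_of_all _ fun x => ?_)
    simp only [hkf]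
    ring
  -- reversal invariance of the kinetic pairings
  have hreva : ∫ x, rev gb x * (γ * ((x.2 ⟨0, by omega⟩ ^ 2 - T) + (x.2 ⟨N - 1, by omega⟩ ^ 2 - T))) *
      P.gibbsDensity (N + M) T x =
      γ * ((∫ x, gb x * (x.2 ⟨0, by omega⟩ ^ 2 - T) * P.gibbsDensity (N + M) T x) +
        ∫ x, gb x * (x.2 ⟨N - 1, by omega⟩ ^ 2 - T) * P.gibbsDensity (N + M) T x) := by
    have h := integral_rev_mul_gibbsDensity P T
      (fun x => gb x * (γ * ((x.2 ⟨0, by omega⟩ ^ 2 - T) + (x.2 ⟨N - 1, by omega⟩ ^ 2 - T))))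
    have e1 : (fun x => rev (fun x => gb x * (γ * ((x.2 ⟨0, by omega⟩ ^ 2 - T) + (x.2 ⟨N - 1, by omega⟩ ^ 2 - T)))) x *
        P.gibbsDensity (N + M) T x) = fun x => rev gb x * (γ * ((x.2 ⟨0, by omega⟩ ^ 2 - T) +
          (x.2 ⟨N - 1, by omega⟩ ^ 2 - T))) * P.gibbsDensity (N + M) T x := by
      funext x; simp only [rev_apply, Pi.neg_apply, neg_sq]
    rw [e1] at h
    rw [h, ← integral_add hIa hIb, ← integral_const_mul]
    exact integral_congr_ae (ae_of_all _ fun x => by ring)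
  rw [hsplit, hreva, hT2] at hcross
  exact hcross

/-- **JUNCTION POWER PAIRING (fixed `N`, `M`; exact).** For the pinned chain (`ω₂ > 0`, `lam, β ≥ 0`,
`γ, T > 0`, `N, M ≥ 1`) and a classical forward field `gb ∈ C² ∩ L²(μ_T^{(N+M)})` of bath 1 of the
`(N, M)`-device (`L_dev gb = −(p_0² − T)`), the backward field `gb∘R` tested against the junction power is a
combination of two Kubo pairings of `gb`:
`⟨gb∘R, V'(q_N − q_{N−1}) p_{N−1}⟩_{μ^{(N+M)}} = γ(⟨gb, p_0² − T⟩ + ⟨gb, p²_{N−1} − T⟩) − T²`. -/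
theorem junctionPower_pairing (hω : 0 < ω₂) (hl : 0 ≤ lam) (hβ : 0 ≤ β) {γ : ℝ} (hγ : 0 < γ)
    (hN : 1 ≤ N) (hM : 1 ≤ M) {T : ℝ} (hT : 0 < T)
    {gb : PhaseSpace (N + M) → ℝ} (hbC : ContDiff ℝ 2 gb)
    (hbL2 : MemLp gb 2 ((pinnedChain ω₂ lam β γ).gibbsMeasure (N + M) T))
    (hbpde : ∀ x, deviceGenerator (pinnedChain ω₂ lam β γ) N M (fun _ => T) gb x = -(kin (N + M) 0 x - T)) :
    ∫ x, gb (x.1, -x.2) *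
        (((x.1 ⟨N, by omega⟩ - x.1 ⟨N - 1, by omega⟩) + β * (x.1 ⟨N, by omega⟩ - x.1 ⟨N - 1, by omega⟩) ^ 3) *
          x.2 ⟨N - 1, by omega⟩) ∂((pinnedChain ω₂ lam β γ).gibbsMeasure (N + M) T) =
      γ * ((∫ x, gb x * (kin (N + M) 0 x - T) ∂((pinnedChain ω₂ lam β γ).gibbsMeasure (N + M) T)) +
          ∫ x, gb x * (kin (N + M) (N - 1) x - T) ∂((pinnedChain ω₂ lam β γ).gibbsMeasure (N + M) T)) - T ^ 2 := by
  have hcross := junctionPower_pairing_density hω hl hβ hγ hN hM hT hbC hbL2 hbpde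
  have hZ : 0 < ∫ x, (pinnedChain ω₂ lam β γ).gibbsDensity (N + M) T x := partition_pos hω hl hβ (N + M) hT
  rw [(pinnedChain ω₂ lam β γ).integral_gibbsMeasure, (pinnedChain ω₂ lam β γ).integral_gibbsMeasure,
    (pinnedChain ω₂ lam β γ).integral_gibbsMeasure]
  have ea : ∫ x, gb x * (kin (N + M) 0 x - T) * (pinnedChain ω₂ lam β γ).gibbsDensity (N + M) T x =
      ∫ x, gb x * (x.2 ⟨0, by omega⟩ ^ 2 - T) * (pinnedChain ω₂ lam β γ).gibbsDensity (N + M) T x :=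
    integral_congr_ae (ae_of_all _ fun x => by dsimp only; rw [kin_eq_sq_line (show 0 < N + M by omega)])
  have eb : ∫ x, gb x * (kin (N + M) (N - 1) x - T) * (pinnedChain ω₂ lam β γ).gibbsDensity (N + M) T x =
      ∫ x, gb x * (x.2 ⟨N - 1, by omega⟩ ^ 2 - T) * (pinnedChain ω₂ lam β γ).gibbsDensity (N + M) T x :=
    integral_congr_ae (ae_of_all _ fun x => by dsimp only; rw [kin_eq_sq_line (show N - 1 < N + M by omega)])
  have eJ : ∫ x, gb (x.1, -x.2) *
      (((x.1 ⟨N, by omega⟩ - x.1 ⟨N - 1, by omega⟩) + β * (x.1 ⟨N, by omega⟩ - x.1 ⟨N - 1, by omega⟩) ^ 3) *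
        x.2 ⟨N - 1, by omega⟩) * (pinnedChain ω₂ lam β γ).gibbsDensity (N + M) T x =
      ∫ x, rev gb x *
        (((x.1 ⟨N, by omega⟩ - x.1 ⟨N - 1, by omega⟩) + β * (x.1 ⟨N, by omega⟩ - x.1 ⟨N - 1, by omega⟩) ^ 3) *
          x.2 ⟨N - 1, by omega⟩) * (pinnedChain ω₂ lam β γ).gibbsDensity (N + M) T x :=
    integral_congr_ae (ae_of_all _ fun x => rfl)
  rw [ea, eb, eJ]
  have hinv : (∫ x, (pinnedChain ω₂ lam β γ).gibbsDensity (N + M) T x)⁻¹ *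
      ∫ x, (pinnedChain ω₂ lam β γ).gibbsDensity (N + M) T x = 1 := inv_mul_cancel₀ hZ.ne'
  linear_combination -((∫ x, (pinnedChain ω₂ lam β γ).gibbsDensity (N + M) T x)⁻¹ * hcross) - T ^ 2 * hinv

end JunctionPower

/-! ## The registered helpers -/

section Assembly

open Summit.AtomisticToContinuum.FouriersLaw.Theorems.SuperadditiveResistance.Kubo (rev rev_apply memLp_rev)
open Summit.AtomisticToContinuum.FouriersLaw.Theorems.SuperadditiveResistance.TerminationLocality
  (memLp_comp_restrictLeft)

/-- **Registered helper `helper_terminationJunctionPower` (toward `stub_terminationLocalityTC`).** Along an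
equilibrium Kubo frame `KuboFrame P T N M g gb₁ gb₄` of the γ-probed device (`N, M ≥ 1`; all parameters
`> 0`, `lam, β ≥ 0` suffice): `⟨gb₁∘R, V'(q_N − q_{N−1}) p_{N−1}⟩_{μ^{(N+M)}} = −(T²/γ)(g₀₂ + g₀₃)` —
by `junctionPower_pairing` and the frame's Kubo rows `⟨gb₁, p_0² − T⟩ = (T²/γ²)(γ − selfLeft g)`,
`⟨gb₁, p²_{N−1} − T⟩ = (T²/γ²)g₀₁`, `selfLeft g = g₀₁ + g₀₂ + g₀₃`. This is the EXACT value of the mean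
(`p_{N−1}`-linear) part of the dynamic termination remainder. -/
theorem helper_terminationJunctionPower : ∀ (ω₂ lam β γ T : ℝ), 0 < ω₂ → 0 ≤ lam → 0 ≤ β → 0 < γ → 0 < T → ∀ (N M : ℕ) (hN : 1 ≤ N) (hM : 1 ≤ M) (g : Fin 4 → Fin 4 → ℝ) (gb₁ gb₄ : PhaseSpace (N + M) → ℝ), KuboFrame (pinnedChain ω₂ lam β γ) T N M g gb₁ gb₄ → ∫ x, gb₁ (x.1, -x.2) * (((x.1 ⟨N, by omega⟩ - x.1 ⟨N - 1, by omega⟩) + β * (x.1 ⟨N, by omega⟩ - x.1 ⟨N - 1, by omega⟩) ^ 3) * x.2 ⟨N - 1, by omega⟩) ∂((pinnedChain ω₂ lam β γ).gibbsMeasure (N + M) T) = -(T ^ 2 / γ) * (g 0 2 + g 0 3) := by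
  intro ω₂ lam β γ T hω hl hβ hγ hT N M hN hM g gb₁ gb₄ hKF
  obtain ⟨-, -, hff, -, hrow, hself, -, -⟩ := hKF
  obtain ⟨hbC, hbL2, -, -, hbpde⟩ := hff
  have hγ' : (pinnedChain ω₂ lam β γ).γ = γ := rfl
  rw [hγ'] at hrow hself
  have h01 := hrow 1 (by decide)
  have e1 : termSite N M 1 = N - 1 := rfl
  rw [e1] at h01
  rw [junctionPower_pairing hω hl hβ hγ hN hM hT hbC hbL2 hbpde]
  have hγ0 : γ ≠ 0 := hγ.ne'
  have hT0 : T ≠ 0 := hT.ne'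
  have ea : ∫ x, gb₁ x * (kin (N + M) 0 x - T) ∂((pinnedChain ω₂ lam β γ).gibbsMeasure (N + M) T) =
      T ^ 2 / γ ^ 2 * (γ - selfLeft g) := by
    rw [hself]; field_simp; ring
  have eb : ∫ x, gb₁ x * (kin (N + M) (N - 1) x - T) ∂((pinnedChain ω₂ lam β γ).gibbsMeasure (N + M) T) =
      T ^ 2 / γ ^ 2 * g 0 1 := by
    rw [h01]; field_simp
  rw [ea, eb]
  unfold selfLeft
  field_simp
  ring

/-- **Registered helper `helper_terminationSplit` — THE SPLIT TERMINATION IDENTITY (fixed `N`, `M`; exact).**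
Along the plain frame `PlainFrame P T N h G` of the bare `N`-piece and the Kubo frame of the device, for
every classical forward field `g_N ∈ C² ∩ L²(μ_T^{(N)})` of the bare piece's left bath:
`selfLeft g − G = (G/γ)(g₀₂ + g₀₃) − (γ²/T²)(S_N + Dyn_N^{fl})`, with the static tilt
`S_N = ⟨g_N∘π_N, p_0² − T⟩_{μ^{(N+M)}} − ⟨g_N, p_0² − T⟩_{μ^{(N)}}` and the FLUCTUATING dynamic remainder
`Dyn_N^{fl} = ⟨gb₁∘R, V'(q_N − q_{N−1})·((∂_{p_{N−1}} g_N)∘π_N − (G/γ²) p_{N−1})⟩_{μ^{(N+M)}}`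
(`terminationIdentity_left` with the end gradient split along `p_{N−1}`, the mean part evaluated by
`helper_terminationJunctionPower`). With `G = G_N = D N/(N−1)` the subtracted multiple of `p_{N−1}` is the
exact `L²(μ^{(N)})`-projection of the end gradient (`helper_terminationEndGradient`). -/
theorem helper_terminationSplit : ∀ (ω₂ lam β γ T : ℝ), 0 < ω₂ → 0 ≤ lam → 0 < β → 0 < γ → 0 < T → ∀ (N M : ℕ) (hN : 1 ≤ N) (hM : 1 ≤ M) (h : PhaseSpace N → ℝ) (G : ℝ) (g : Fin 4 → Fin 4 → ℝ) (gb₁ gb₄ : PhaseSpace (N + M) → ℝ) (gN : PhaseSpace N → ℝ), PlainFrame (pinnedChain ω₂ lam β γ) T N h G → KuboFrame (pinnedChain ω₂ lam β γ) T N M g gb₁ gb₄ → ContDiff ℝ 2 gN → MemLp gN 2 ((pinnedChain ω₂ lam β γ).gibbsMeasure N T) → (∀ y, (pinnedChain ω₂ lam β γ).generator N T T gN y = -(kin N 0 y - T)) → selfLeft g - G = G / γ * (g 0 2 + g 0 3) - (γ ^ 2 / T ^ 2) * (((∫ x, gN (x.1 ∘ Fin.castAdd M, x.2 ∘ Fin.castAdd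 M) * (kin (N + M) 0 x - T) ∂((pinnedChain ω₂ lam β γ).gibbsMeasure (N + M) T)) - ∫ y, gN y * (kin N 0 y - T) ∂((pinnedChain ω₂ lam β γ).gibbsMeasure N T)) + ∫ x, gb₁ (x.1, -x.2) * ((((x.1 ⟨N, by omega⟩ - x.1 ⟨N - 1, by omega⟩) + β * (x.1 ⟨N, by omega⟩ - x.1 ⟨N - 1, by omega⟩) ^ 3) * (partialP ⟨N - 1, by omega⟩ gN (x.1 ∘ Fin.castAdd M, x.2 ∘ Fin.castAdd M) - G / γ ^ 2 * x.2 ⟨N - 1, by omega⟩))) ∂((pinnedChain ω₂ lam β γ).gibbsMeasure (N + M) T)) := by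
  intro ω₂ lam β γ T hω hl hβ hγ hT N M hN hM h G g gb₁ gb₄ gN hPF hKF hgC hgL2 hgpde
  have hid := terminationIdentity_left ω₂ lam β γ T hω hl hβ hγ hT N M hN hM h G g gb₁ gb₄ gN hPF hKF hgC hgL2 hgpde
  have hJP := helper_terminationJunctionPower ω₂ lam β γ T hω hl hβ.le hγ hT N M hN hM g gb₁ gb₄ hKF
  obtain ⟨-, -, ⟨hbC, hbL2, -, -, -⟩, -⟩ := hKF
  set μ := (pinnedChain ω₂ lam β γ).gibbsMeasure (N + M) T with hμ
  have hrevL2 : MemLp (rev gb₁) 2 μ := memLp_rev hω hl hβ.le (N + M) hT hbC.continuous hbL2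
  have hdg := memLp_partialP_plainField hω hl hβ.le hγ hN hT hgC hgL2 hgpde
  have hVd : MemLp (fun x : PhaseSpace (N + M) =>
      ((x.1 ⟨N, by omega⟩ - x.1 ⟨N - 1, by omega⟩) + β * (x.1 ⟨N, by omega⟩ - x.1 ⟨N - 1, by omega⟩) ^ 3) *
        partialP ⟨N - 1, by omega⟩ gN (x.1 ∘ Fin.castAdd M, x.2 ∘ Fin.castAdd M)) 2 μ :=
    memLp_junctionForce_mul_comp_restrictLeft hω hl hβ.le γ hN hM hT
      (continuous_partialP (hgC.of_le (by norm_cast) : ContDiff ℝ 1 gN) one_ne_zero _) hdg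
  have hVp : MemLp (fun x : PhaseSpace (N + M) =>
      ((x.1 ⟨N, by omega⟩ - x.1 ⟨N - 1, by omega⟩) + β * (x.1 ⟨N, by omega⟩ - x.1 ⟨N - 1, by omega⟩) ^ 3) *
        x.2 ⟨N - 1, by omega⟩) 2 μ :=
    memLp_junctionForce_mul_comp_restrictLeft hω hl hβ.le γ hN hM hT (Φ := fun y : PhaseSpace N => y.2 ⟨N - 1, by omega⟩)
      (by fun_prop) (memLp_momentum hω hl hβ.le N hT ⟨N - 1, by omega⟩)
  have hIfull : Integrable (fun x : PhaseSpace (N + M) => gb₁ (x.1, -x.2) *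
      (((x.1 ⟨N, by omega⟩ - x.1 ⟨N - 1, by omega⟩) + β * (x.1 ⟨N, by omega⟩ - x.1 ⟨N - 1, by omega⟩) ^ 3) *
        partialP ⟨N - 1, by omega⟩ gN (x.1 ∘ Fin.castAdd M, x.2 ∘ Fin.castAdd M))) μ :=
    hrevL2.integrable_mul hVd
  have hIp : Integrable (fun x : PhaseSpace (N + M) => G / γ ^ 2 * (gb₁ (x.1, -x.2) *
      (((x.1 ⟨N, by omega⟩ - x.1 ⟨N - 1, by omega⟩) + β * (x.1 ⟨N, by omega⟩ - x.1 ⟨N - 1, by omega⟩) ^ 3) *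
        x.2 ⟨N - 1, by omega⟩))) μ :=
    (hrevL2.integrable_mul hVp).const_mul (G / γ ^ 2)
  have e : ∫ x, gb₁ (x.1, -x.2) *
      ((((x.1 ⟨N, by omega⟩ - x.1 ⟨N - 1, by omega⟩) + β * (x.1 ⟨N, by omega⟩ - x.1 ⟨N - 1, by omega⟩) ^ 3) *
        (partialP ⟨N - 1, by omega⟩ gN (x.1 ∘ Fin.castAdd M, x.2 ∘ Fin.castAdd M) - G / γ ^ 2 * x.2 ⟨N - 1, by omega⟩))) ∂μ =
      (∫ x, gb₁ (x.1, -x.2) *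
        (((x.1 ⟨N, by omega⟩ - x.1 ⟨N - 1, by omega⟩) + β * (x.1 ⟨N, by omega⟩ - x.1 ⟨N - 1, by omega⟩) ^ 3) *
          partialP ⟨N - 1, by omega⟩ gN (x.1 ∘ Fin.castAdd M, x.2 ∘ Fin.castAdd M)) ∂μ) -
        G / γ ^ 2 * ∫ x, gb₁ (x.1, -x.2) *
          (((x.1 ⟨N, by omega⟩ - x.1 ⟨N - 1, by omega⟩) + β * (x.1 ⟨N, by omega⟩ - x.1 ⟨N - 1, by omega⟩) ^ 3) *
            x.2 ⟨N - 1, by omega⟩) ∂μ := by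
    rw [← integral_const_mul, ← integral_sub hIfull hIp]
    exact integral_congr_ae (ae_of_all _ fun x => by ring)
  have hγ0 : γ ≠ 0 := hγ.ne'
  have hT0 : T ≠ 0 := hT.ne'
  have key : γ ^ 2 / T ^ 2 * (G / γ ^ 2 * (T ^ 2 / γ * (g 0 2 + g 0 3))) = G / γ * (g 0 2 + g 0 3) := by
    field_simp
  rw [hid, e, hJP]
  linear_combination key

end Assembly

end Summit.AtomisticToContinuum.FouriersLaw.Cruxes.SuperadditiveResistance.ThermaliseThenCutProbeInsertion

end
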